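import Summits.QuantumFields.BalabanUV.T4Continuum.Support.CovariantVectorChartFactorisation

/-!
# T⁴ programme, SUBSTRATE (shared lattice-gauge analysis library) — AN EXPLICIT HOLOMORPHY RADIUS: the closed-form chart modulus
# `‖ΔQ_n(e^{A}R⁰, (R⁰)⁻¹e^{−A}) − ΔQ_n(R⁰, (R⁰)*)‖ ≤ modulus(n, d, a′, |o|, ℓ, ‖A‖)` and the radius
# `rho0 = min (1/(3ℓ+1)) (γ/(42·d·n² + 96·a′·|o|²·ℓ + 1))` inside which `deltaQT` is invertible with `‖greenT‖ ≤ 2/γ`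
# (VECJ-H (c) EXPLICIT, typer NEXT gen 6 item 1(c); follower of `CovariantVectorCoerciveHolo`)

Substrate cell `b2b-balaban-substrate-*`, seat p3.  `CovariantVectorCoerciveHolo.exists_holoBall` gives the ball by CONTINUITY; here the modulus of the
chart map is made EXPLICIT by OPERATOR-NORM perturbation (the crude, true route — see HONEST SIZING), from the tools of `CovariantVectorChartModulus`:
 * §4 **`modulus n d a′ co ℓ t = d·n²·δ·(δ + 4) + a′·co·E·(2(2co + 1) + co·E)`**
   (`δ = t·e^t`, `E = Etr δ ℓ`), `opNorm_mass_sub_le`, **`opNorm_deltaQT_chart_sub_le`**: for unitary `R⁰`, contours of length `≤ ℓ`, `a′ ≥ 0`, every `A`: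
   `‖deltaQT n (a′n^d) Γ (expChart R⁰ A) (expChartInv R⁰ A) − deltaQT … R⁰ (adjOf R⁰)‖ ≤ modulus n d a′ |o| ℓ ‖A‖`;
 * §5 **`rho0 n d a′ co ℓ γ := min (1/(3ℓ+1)) (γ/(42·d·n² + 96·a′·co²·ℓ + 1))`** (`rho0_pos`), **`modulus_le_half`** (`0 ≤ t < rho0 → modulus ≤ γ/2`;
   elementary: `e^t ≤ 3`, `δ ≤ 3t`, `ℓδ ≤ 1`, `(1 + δ)^ℓ − 1 ≤ e^{ℓδ} − 1 ≤ 2ℓδ`), whence **`isUnit_det_deltaQT_of_norm_lt_rho0`**,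
   **`opNorm_greenT_le_of_norm_lt_rho0`** (`≤ 2/γ`) and the tower junction **`inHoloBallT_rho0_subset_regularSetAt`** (level-`k` letters `c = lev k`,
   `a = a′·(lev k)^d`; the radius a row can DISPLAY as `D.R ≤ rho0`).
HONEST SIZING ∕ LABEL (typer NEXT gen 7 item 1(B)).  TYPE-LEVEL ∕ K-wiring radius ONLY: `rho0 ∝ n⁻²` is NOT of scaling form — by t4-ne9-p1's
`NE9ChartRadiusScaling.not_holoRadiusCompat_sq` (p222672) it cannot carry Bałaban's domain `‖A‖ < α₁/lev L j`; the END consumes v1's by-continuity names;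
the FORM-RELATIVE radius in scaling form (`rhoStar/n`) is the sibling module `CovariantVectorCoerciveHoloForm`.  `ℓ` bounds the contour lengths of `Γ`
(standard contours: `ℓ = (d+1)·n`).  Every constant is symbolic-and-true; nothing printed is a hypothesis.

HONEST FRAMING (T4-DAG p. 1).  Finite-dimensional linear algebra ([folklore]); no estimate of any NE row; no `def … : Prop`; spine 0/9 unchanged; NOT
infinite volume ∕ mass gap ∕ Clay.  HONEST DEPENDENCY: continuum YM on T⁴ ⇐ BetaPertH ∧ nine spine estimates (0/9 proved); BetaPertH ⇐ (D1) ∧ (D4) ∧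
CAP+tail; G-an2-4 gates asym, D1 and NE2/3/4.  ABSOLUTE RULE kept; no `sorry`.
-/

noncomputable section

open scoped BigOperators ComplexConjugate Matrix Matrix.Norms.L2Operator Kronecker ComplexOrder

namespace Summit.QuantumFields.BalabanUV.T4Continuum.CovariantVectorCoerciveHoloExplicit

open Literature.MathematicalPhysics.QuantumFieldTheory.Balaban1983to89.B5Prop11Plancherel (Tor fine shiftM)
open Literature.MathematicalPhysics.QuantumFieldTheory.Balaban1983to89.B5Block118 (QvOp bpt tstep)
open Summit.QuantumFields.BalabanUV.T4Continuum
open Summit.QuantumFields.BalabanUV.T4Continuum.CovariantBlockAveraging (transport ContourSystem Qcov)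
open Summit.QuantumFields.BalabanUV.T4Continuum.CoerciveInverseTower (Coercive)
open Summit.QuantumFields.BalabanUV.T4Continuum.SubstrateTransporterSpecies
open Summit.QuantumFields.BalabanUV.T4Continuum.CovariantVectorCoercive (vecOp)
open Summit.QuantumFields.BalabanUV.T4Continuum.CovariantVectorCoerciveHolo
open Summit.QuantumFields.BalabanUV.T4Continuum.CovariantVectorChartModulus
open Summit.QuantumFields.BalabanUV.T4Continuum.CovariantVectorChartFactorisation (QcovA_eq_conjTranspose Etr Etr_nonneg opNorm_avg_sub_le)

variable {d : ℕ} {o : Type*} [Fintype o] [DecidableEq o] [Nonempty o]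
variable (n : ℕ) [NeZero n] (M : Fin d → ℕ) [hM : ∀ μ, NeZero (M μ)]

/-! ## §4 The explicit modulus of the chart map -/

/-- **THE EXPLICIT CHART MODULUS** `modulus n d a′ co ℓ t = d·n²·δ·(δ + 4) + a′·co·E·(2(2co + 1) + co·E)`, `δ = t·e^t`, `E = (1 + δ)^ℓ − 1`. [folklore] -/
def modulus (n d : ℕ) (a' : ℝ) (co ℓ : ℕ) (t : ℝ) : ℝ :=
  d * (n : ℝ) ^ 2 * (t * Real.exp t) * (t * Real.exp t + 4) + a' * co * Etr (t * Real.exp t) ℓ * (2 * (2 * co + 1) + co * Etr (t * Real.exp t) ℓ)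

/-- **THE MASS-TERM DIFFERENCE** `‖a·(Qᴬ(S)Q(R) − Qᴬ(S′)Q(R′))‖ ≤ |a|·n^{−d}·|o|·E·(2(2|o| + 1) + |o|·E)` (from `opNorm_avg_sub_le`). [folklore] -/
theorem opNorm_mass_sub_le (Γ : ContourSystem d n M) {ℓ : ℕ} (hΓ : ∀ y j μ (t : Fin n), (Γ y j μ t).length ≤ ℓ) (a : ℝ)
    {R R' S S' : Fin d → (Tor (fine n M) × Fin d → Matrix o o ℂ)} {δ : ℝ} (hδ : 0 ≤ δ)
    (hR' : ∀ ν i, ‖R' ν i‖ ≤ 1) (hS' : ∀ ν i, ‖S' ν i‖ ≤ 1) (hRR' : ∀ ν i, ‖R ν i - R' ν i‖ ≤ δ) (hSS' : ∀ ν i, ‖S ν i - S' ν i‖ ≤ δ) :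
    ‖(a : ℂ) • (QcovA n M Γ S * Qcov n M Γ R) - (a : ℂ) • (QcovA n M Γ S' * Qcov n M Γ R')‖
      ≤ |a| * ((n : ℝ) ^ d)⁻¹ * (Fintype.card o * Etr δ ℓ * (2 * (2 * Fintype.card o + 1) + Fintype.card o * Etr δ ℓ)) := by
  rw [← smul_sub, norm_smul, Complex.norm_real, Real.norm_eq_abs, mul_assoc]
  exact mul_le_mul_of_nonneg_left (opNorm_avg_sub_le n M Γ hΓ hδ hR' hS' hRR' hSS') (abs_nonneg a)

/-- **THE EXPLICIT MODULUS OF THE CHART MAP**: for a unitary reference field `R⁰`, contours of length `≤ ℓ`, `a′ ≥ 0` and every chart coordinate `A`,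
`‖ΔQ_n(e^{A}R⁰, (R⁰)⁻¹e^{−A}) − ΔQ_n(R⁰, (R⁰)*)‖ ≤ modulus n d a′ |o| ℓ ‖A‖` (letters `c = n`, `a = a′·n^d`). [folklore] -/
theorem opNorm_deltaQT_chart_sub_le (Γ : ContourSystem d n M) {ℓ : ℕ} (hΓ : ∀ y j μ (t : Fin n), (Γ y j μ t).length ≤ ℓ) {a' : ℝ} (ha' : 0 ≤ a')
    {R₀ : Fin d → (Tor (fine n M) × Fin d → Matrix o o ℂ)} (hR₀ : ∀ ν i, R₀ ν i ∈ Matrix.unitaryGroup o ℂ)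
    (A : Fin d → (Tor (fine n M) × Fin d → Matrix o o ℂ)) :
    ‖deltaQT n M ((n : ℕ) : ℂ) (a' * (n : ℝ) ^ d) Γ (expChart R₀ A) (expChartInv R₀ A) - deltaQT n M ((n : ℕ) : ℂ) (a' * (n : ℝ) ^ d) Γ R₀ (adjOf R₀)‖
      ≤ modulus n d a' (Fintype.card o) ℓ ‖A‖ := by
  have hn : (0 : ℝ) < (n : ℝ) ^ d := pow_pos (by exact_mod_cast Nat.pos_of_ne_zero (NeZero.ne n)) d
  set δ : ℝ := ‖A‖ * Real.exp ‖A‖ with hδdef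
  have hδ : 0 ≤ δ := by positivity
  have hR' : ∀ ν i, ‖R₀ ν i‖ ≤ 1 := fun ν i => (norm_of_unitary (hR₀ ν i)).le
  have hS' : ∀ ν i, ‖adjOf R₀ ν i‖ ≤ 1 := fun ν i => by rw [adjOf_apply, Matrix.l2_opNorm_conjTranspose]; exact hR' ν i
  have hRR' : ∀ ν i, ‖expChart R₀ A ν i - R₀ ν i‖ ≤ δ := fun ν i => norm_expChart_sub_le hR₀ A ν i
  have hSS' : ∀ ν i, ‖expChartInv R₀ A ν i - adjOf R₀ ν i‖ ≤ δ := fun ν i => norm_expChartInv_sub_le hR₀ A ν i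
  have hR : ∀ ν i, ‖expChart R₀ A ν i‖ ≤ 1 + δ := fun ν i => norm_expChart_le hR₀ A ν i
  have h1 : ‖covLapT (fine n M) ((n : ℕ) : ℂ) (expChart R₀ A) (expChartInv R₀ A) - covLapT (fine n M) ((n : ℕ) : ℂ) R₀ (adjOf R₀)‖
      ≤ d * (n : ℝ) ^ 2 * δ * (δ + 4) := by
    have h := opNorm_covLapT_sub_le (fine n M) ((n : ℕ) : ℂ) (by positivity : (0 : ℝ) ≤ 1 + δ) hδ hR hS' hRR' hSS'
    rw [Complex.norm_natCast] at h
    calc _ ≤ _ := h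
      _ = d * (n : ℝ) ^ 2 * δ * (δ + 4) := by ring
  have h2 : ‖((a' * (n : ℝ) ^ d : ℝ) : ℂ) • (QcovA n M Γ (expChartInv R₀ A) * Qcov n M Γ (expChart R₀ A))
        - ((a' * (n : ℝ) ^ d : ℝ) : ℂ) • (QcovA n M Γ (adjOf R₀) * Qcov n M Γ R₀)‖
      ≤ a' * (Fintype.card o * Etr δ ℓ * (2 * (2 * Fintype.card o + 1) + Fintype.card o * Etr δ ℓ)) := by
    have h := opNorm_mass_sub_le n M Γ hΓ (a' * (n : ℝ) ^ d) hδ hR' hS' hRR' hSS'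
    rwa [abs_of_nonneg (by positivity : (0 : ℝ) ≤ a' * (n : ℝ) ^ d), mul_assoc a' ((n : ℝ) ^ d), mul_inv_cancel₀ hn.ne', mul_one] at h
  rw [deltaQT, deltaQT, add_sub_add_comm]
  calc _ ≤ d * (n : ℝ) ^ 2 * δ * (δ + 4) + a' * (Fintype.card o * Etr δ ℓ * (2 * (2 * Fintype.card o + 1) + Fintype.card o * Etr δ ℓ)) :=
        (norm_add_le _ _).trans (add_le_add h1 h2)
    _ = modulus n d a' (Fintype.card o) ℓ ‖A‖ := by rw [modulus, hδdef]; ring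

/-! ## §5 The explicit radius -/

/-- **THE EXPLICIT RADIUS** `rho0 n d a′ co ℓ γ = min (1/(3ℓ + 1)) (γ/(42·d·n² + 96·a′·co²·ℓ + 1))`. [folklore] -/
def rho0 (n d : ℕ) (a' : ℝ) (co ℓ : ℕ) (γ : ℝ) : ℝ :=
  min (1 / (3 * (ℓ : ℝ) + 1)) (γ / (42 * d * (n : ℝ) ^ 2 + 96 * a' * (co : ℝ) ^ 2 * ℓ + 1))

omit [Fintype o] [DecidableEq o] [Nonempty o] [NeZero n] hM in
/-- `rho0 > 0` for `γ > 0`, `a′ ≥ 0`. [folklore] -/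
theorem rho0_pos {a' γ : ℝ} (ha' : 0 ≤ a') (hγ : 0 < γ) (co ℓ : ℕ) : 0 < rho0 n d a' co ℓ γ := by
  unfold rho0
  exact lt_min (by positivity) (by positivity)

omit [Fintype o] [DecidableEq o] [Nonempty o] [NeZero n] hM in
/-- **inside the radius the modulus is at most `γ/2`** (elementary: `e^t ≤ 3`, `δ ≤ 3t`, `ℓδ ≤ 1`, `(1 + δ)^ℓ − 1 ≤ e^{ℓδ} − 1 ≤ 2ℓδ`). [folklore] -/
theorem modulus_le_half {a' γ t : ℝ} (ha' : 0 ≤ a') (hγ : 0 < γ) {co : ℕ} (hco : 1 ≤ co) (ℓ : ℕ) (ht0 : 0 ≤ t)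
    (ht : t < rho0 n d a' co ℓ γ) : modulus n d a' co ℓ t ≤ γ / 2 := by
  have hℓ : (0 : ℝ) ≤ ℓ := Nat.cast_nonneg _
  have hco1 : (1 : ℝ) ≤ co := by exact_mod_cast hco
  have ht1 : t ≤ 1 / (3 * (ℓ : ℝ) + 1) := (ht.le.trans (min_le_left _ _))
  have ht2 : t ≤ γ / (42 * d * (n : ℝ) ^ 2 + 96 * a' * (co : ℝ) ^ 2 * ℓ + 1) := ht.le.trans (min_le_right _ _)
  have ht1' : t ≤ 1 := ht1.trans (by rw [div_le_one (by positivity)]; linarith)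
  -- `e^t ≤ 3`, `δ ≤ 3t`
  have he : Real.exp t ≤ 3 := (Real.exp_le_exp.mpr ht1').trans (by have := Real.exp_one_lt_d9; norm_num at this ⊢; linarith)
  set δ := t * Real.exp t with hδdef
  have hδ0 : 0 ≤ δ := by positivity
  have hδ3 : δ ≤ 3 * t := by rw [hδdef, mul_comm]; exact mul_le_mul_of_nonneg_right he ht0
  -- `ℓδ ≤ 1`
  have hℓδ : (ℓ : ℝ) * δ ≤ 1 := by
    have h1 : (ℓ : ℝ) * δ ≤ ℓ * (3 * t) := mul_le_mul_of_nonneg_left hδ3 hℓ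
    have h2 : (3 * (ℓ : ℝ) + 1) * t ≤ 1 := by rwa [le_div_iff₀ (by positivity), mul_comm] at ht1
    nlinarith
  -- `E ≤ 2ℓδ ≤ 6ℓt`, `E ≤ 2`
  have hE : Etr δ ℓ ≤ 2 * (ℓ * δ) := by
    have hpow : (1 + δ) ^ ℓ ≤ Real.exp (ℓ * δ) := by
      rw [Real.exp_nat_mul]; exact pow_le_pow_left₀ (by linarith) (by linarith [Real.add_one_le_exp δ]) ℓ
    have habs : |Real.exp (ℓ * δ) - 1| ≤ 2 * |(ℓ : ℝ) * δ| := Real.abs_exp_sub_one_le (by rw [abs_of_nonneg (by positivity)]; exact hℓδ)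
    rw [abs_of_nonneg (by positivity : (0 : ℝ) ≤ ℓ * δ)] at habs
    have := (le_abs_self _).trans habs
    show (1 + δ) ^ ℓ - 1 ≤ 2 * (ℓ * δ)
    linarith
  have hE0 : 0 ≤ Etr δ ℓ := Etr_nonneg hδ0 ℓ
  have hE6 : Etr δ ℓ ≤ 6 * ℓ * t := hE.trans (by nlinarith)
  have hE2 : Etr δ ℓ ≤ 2 := hE.trans (by nlinarith)
  -- the two terms
  have hA : (d : ℝ) * (n : ℝ) ^ 2 * δ * (δ + 4) ≤ 21 * d * (n : ℝ) ^ 2 * t := by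
    have hdn : (0 : ℝ) ≤ d * (n : ℝ) ^ 2 := by positivity
    have h7 : δ + 4 ≤ 7 := by nlinarith
    calc (d : ℝ) * (n : ℝ) ^ 2 * δ * (δ + 4) = (d * (n : ℝ) ^ 2) * (δ * (δ + 4)) := by ring
      _ ≤ (d * (n : ℝ) ^ 2) * ((3 * t) * 7) := mul_le_mul_of_nonneg_left (mul_le_mul hδ3 h7 (by positivity) (by positivity)) hdn
      _ = 21 * d * (n : ℝ) ^ 2 * t := by ring
  have hB : a' * co * Etr δ ℓ * (2 * (2 * co + 1) + co * Etr δ ℓ) ≤ 48 * a' * (co : ℝ) ^ 2 * ℓ * t := by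
    have hbr : 2 * (2 * (co : ℝ) + 1) + co * Etr δ ℓ ≤ 8 * co := by nlinarith
    have hbr0 : 0 ≤ 2 * (2 * (co : ℝ) + 1) + co * Etr δ ℓ := add_nonneg (by positivity) (mul_nonneg (by positivity) hE0)
    calc a' * co * Etr δ ℓ * (2 * (2 * co + 1) + co * Etr δ ℓ) = (a' * co) * (Etr δ ℓ * (2 * (2 * co + 1) + co * Etr δ ℓ)) := by ring
      _ ≤ (a' * co) * ((6 * ℓ * t) * (8 * co)) := mul_le_mul_of_nonneg_left (mul_le_mul hE6 hbr hbr0 (by positivity)) (by positivity)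
      _ = 48 * a' * (co : ℝ) ^ 2 * ℓ * t := by ring
  -- conclude
  have hden : 0 < 42 * d * (n : ℝ) ^ 2 + 96 * a' * (co : ℝ) ^ 2 * ℓ + 1 := by positivity
  have hmain : (21 * d * (n : ℝ) ^ 2 + 48 * a' * (co : ℝ) ^ 2 * ℓ) * t ≤ γ / 2 := by
    have h := mul_le_mul_of_nonneg_left ht2 (by positivity : (0 : ℝ) ≤ 21 * d * (n : ℝ) ^ 2 + 48 * a' * (co : ℝ) ^ 2 * ℓ)
    refine h.trans ?_
    rw [mul_div_assoc', div_le_div_iff₀ hden two_pos]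
    nlinarith
  unfold modulus
  calc _ ≤ 21 * d * (n : ℝ) ^ 2 * t + 48 * a' * (co : ℝ) ^ 2 * ℓ * t := add_le_add hA hB
    _ = (21 * d * (n : ℝ) ^ 2 + 48 * a' * (co : ℝ) ^ 2 * ℓ) * t := by ring
    _ ≤ γ / 2 := hmain

/-- **EXPLICIT INVERTIBILITY**: for a unitary reference field `R⁰` with `γ`-coercive real slice `vecOp n M a′ Γ R⁰` (`γ > 0`, `a′ > 0`), contours of
length `≤ ℓ`, every chart coordinate `A` with `‖A‖ < rho0 n d a′ |o| ℓ γ` gives an invertible `deltaQT`. [folklore] -/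
theorem isUnit_det_deltaQT_of_norm_lt_rho0 (Γ : ContourSystem d n M) {ℓ : ℕ} (hΓ : ∀ y j μ (t : Fin n), (Γ y j μ t).length ≤ ℓ) {a' γ : ℝ}
    (ha' : 0 < a') {R₀ : Fin d → (Tor (fine n M) × Fin d → Matrix o o ℂ)} (hR₀ : ∀ ν i, R₀ ν i ∈ Matrix.unitaryGroup o ℂ)
    (hco : Coercive γ (vecOp n M a' Γ R₀)) (hγ : 0 < γ) {A : Fin d → (Tor (fine n M) × Fin d → Matrix o o ℂ)}
    (hA : ‖A‖ < rho0 n d a' (Fintype.card o) ℓ γ) :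
    IsUnit (deltaQT n M ((n : ℕ) : ℂ) (a' * (n : ℝ) ^ d) Γ (expChart R₀ A) (expChartInv R₀ A)).det :=
  isUnit_det_deltaQT_of_opNorm_sub_le n M hco hγ ((opNorm_deltaQT_chart_sub_le n M Γ hΓ ha'.le hR₀ A).trans
    (modulus_le_half n (d := d) ha'.le hγ Fintype.card_pos ℓ (norm_nonneg A) hA))

/-- **… with `‖greenT‖ ≤ 2/γ`**. [folklore] -/
theorem opNorm_greenT_le_of_norm_lt_rho0 (Γ : ContourSystem d n M) {ℓ : ℕ} (hΓ : ∀ y j μ (t : Fin n), (Γ y j μ t).length ≤ ℓ) {a' γ : ℝ}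
    (ha' : 0 < a') {R₀ : Fin d → (Tor (fine n M) × Fin d → Matrix o o ℂ)} (hR₀ : ∀ ν i, R₀ ν i ∈ Matrix.unitaryGroup o ℂ)
    (hco : Coercive γ (vecOp n M a' Γ R₀)) (hγ : 0 < γ) {A : Fin d → (Tor (fine n M) × Fin d → Matrix o o ℂ)}
    (hA : ‖A‖ < rho0 n d a' (Fintype.card o) ℓ γ) :
    ‖greenT n M ((n : ℕ) : ℂ) (a' * (n : ℝ) ^ d) Γ (expChart R₀ A) (expChartInv R₀ A)‖ ≤ 2 / γ :=
  opNorm_greenT_le_of_opNorm_sub_le n M hco hγ ((opNorm_deltaQT_chart_sub_le n M Γ hΓ ha'.le hR₀ A).trans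
    (modulus_le_half n (d := d) ha'.le hγ Fintype.card_pos ℓ (norm_nonneg A) hA))

/-! ### The tower junction (level-`k` letters) -/

section Tower

open Literature.MathematicalPhysics.QuantumFieldTheory.Balaban1983to89 (Params)
open Summit.QuantumFields.BalabanUV.T4Continuum.SubstrateBackgroundTransporters (unitMod)
open Literature.MathematicalPhysics.QuantumFieldTheory.Balaban1983to89.B5G183RateUnitTower (lev lev_neZero)
open Summit.QuantumFields.BalabanUV.T4Continuum.SubstrateTransporterSpeciesHolo (expChartT expChartInvT regularSetAt)

/-- **EXPLICIT LEVEL JUNCTION**: the tower ball `InHoloBallT P R⁰ (rho0 (lev k) d a′ |o| ℓ γ)` lies in p1's level-`k` regular set (letters `c = lev k`,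
`a = a′·(lev k)^d`), with `‖greenT‖ ≤ 2/γ` — an explicit radius a row can display as `D.R ≤ rho0`. [folklore] -/
theorem inHoloBallT_rho0_subset_regularSetAt (P : Params) (Γ : (k : ℕ) → ContourSystem P.d (lev P.L k) (unitMod P)) {R₀ : TowerData P o}
    (k : Fin (P.K + 1)) {ℓ : ℕ} (hΓ : ∀ y j μ (t : Fin (lev P.L k)), (Γ k y j μ t).length ≤ ℓ) (hR₀ : ∀ ν i, R₀ k ν i ∈ Matrix.unitaryGroup o ℂ)
    {a' γ : ℝ} (ha' : 0 < a') (hco : Coercive γ (vecOp (lev P.L k) (unitMod P) a' (Γ k) (R₀ k))) (hγ : 0 < γ) {A : TowerData P o}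
    (hA : InHoloBallT P R₀ (rho0 (lev P.L k) P.d a' (Fintype.card o) ℓ γ) A) :
    A ∈ regularSetAt P (((lev P.L k : ℕ) : ℂ)) (a' * ((lev P.L k : ℕ) : ℝ) ^ P.d) Γ R₀ k ∧
      ‖greenT (lev P.L k) (unitMod P) (((lev P.L k : ℕ) : ℂ)) (a' * ((lev P.L k : ℕ) : ℝ) ^ P.d) (Γ k) (expChartT P R₀ A k) (expChartInvT P R₀ A k)‖
        ≤ 2 / γ :=
  ⟨isUnit_det_deltaQT_of_norm_lt_rho0 (lev P.L k) (unitMod P) (Γ k) hΓ ha' hR₀ hco hγ (inHoloBallT_apply P hA k),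
    opNorm_greenT_le_of_norm_lt_rho0 (lev P.L k) (unitMod P) (Γ k) hΓ ha' hR₀ hco hγ (inHoloBallT_apply P hA k)⟩

end Tower

end Summit.QuantumFields.BalabanUV.T4Continuum.CovariantVectorCoerciveHoloExplicit

end
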